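import Summits.BirchSwinnertonDyer.BirchSwinnertonDyer.Theorems.BiquadraticEisensteinDescentHeegnerTwistCouplingInSupplyKrizLiCornerCruxBody
import Literature.NumberTheory.EllipticCurves.JZeroGoodReductionTwoTraceProofs
import HarnessLib

set_option linter.dupNamespace false -- `Summit.BirchSwinnertonDyer.BirchSwinnertonDyer.Theorems.…` (summit = sub, D-0017)
set_option autoImplicit false

/-!
# Crux `HeegnerTwistCouplingInSupply` (stmt-BirchSwinnertonDyer-21381) — the Kriz–Li `j = 0` corners WITHOUT the binder `a₂ = 0`

Route `BiquadraticEisensteinDescent` (cell `pub/bsd-wall`, width seat `bsd-wall-cm-bed-w4` g28; `--supports` 21381, helper).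
The QT27₊ / X12₊ corner files of g27 (`…KrizLiCornerQT27`, `…KrizLiCornerX12`, `…KrizLiCornerClassNumberForm`,
`…KrizLiCornerCruxBody`) carry the displayed per-curve binder
`h2 : W.HasGoodReductionAtPrime 2 → W.LFunction 2 = 0` («`a₂(W) = 0` if `W` is good at `2`»). It is now a TREE THEOREM for
EVERY globally minimal `W/ℚ` with `j(W) = 0` (`Literature.NumberTheory.EllipticCurves.JZero.lFunction_two_eq_zero_of_j_eq_zero`,
file `Literature/NumberTheory/EllipticCurves/JZeroGoodReductionTwoTraceProofs.lean`: `c₄ = 0 ⇒ 2 ∣ a₁`; `Δ` odd `⇒ a₃` odd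
`⇒ a₂ ≡ a₄ (2)`; the reduction `y² + y = x³ + a x² + a x + b` has three `𝔽₂`-points), so this file restates the six closers with
`h2` DISCHARGED — same hypotheses otherwise, same conclusions, proofs = the g27 theorem applied to the tree binder:

* `lFunction_two_binder_of_mordell` — the binder for every globally minimal `W` with `C • W = y² = x³ + k`;
* `heegner_and_twist_L_one_ne_zero_of_prime_pair'`, `exists_cruxConclusion_of_prime_pair'` (QT27₊, `q ≡ 5 (mod 12)`);
* `heegner_and_twist_L_one_ne_zero_of_prime_pair_three_mod_four'`, `exists_cruxConclusion_of_prime_pair_three_mod_four'`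
  (X12₊ ∪ QT27₊, `q ≡ 11 (mod 12)`);
* `exists_cruxConclusion_of_classNumbers'`, `exists_cruxConclusion_three_mod_four_of_classNumbers'` (class-number certificates);
* ★ `cruxBody_of_classNumbers'`, ★ `cruxBody_three_mod_four_of_classNumbers'` — the crux's BODY verbatim at `(W, q)`, now modulo
  `hKL` (Kriz–Li 1.20), `hGZ` (Gross–Zagier), `hHP` (Heegner points) and NOTHING per-curve beyond the corner data
  (`W ≅ y² = x³ + q·m²`, bad primes, `r_an ≠ 0`).

HONEST FRAMING: corner layer; the crux (all CM `W`, all `p`), C⁺ / (S3′)(p), its registered stubs and BSD are NOT proved.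
THEOREMS ONLY. Supports stmt-BirchSwinnertonDyer-21381.
[cite: KrizLi2019, Thm. 1.20 (pp. 7–8)] [cite: GrossZagier1986, Thm. I.(6.3), V.§1–2] [cite: IrelandRosen1990, Ch. 18 §3, Theorem 4]
-/

noncomputable section

open scoped Classical NumberTheorySymbols

namespace Summit.BirchSwinnertonDyer.BirchSwinnertonDyer.Theorems.KrizLiCornerGoodAtTwo

open _root_.WeierstrassCurve NumberField
open Literature.NumberTheory.EllipticCurves Literature.NumberTheory.EllipticCurves.KrizLi2019
  Literature.NumberTheory.EllipticCurves.ModularForms Literature.NumberTheory.EllipticCurves.Rank1Residual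
  Literature.NumberTheory.QuadraticFields Literature.NumberTheory.QuadraticFields.Quadratic

/-! ## §0 The binder, discharged -/

/-- **`a₂(W) = 0` if `W` is good at `2`, for every globally minimal `W ≅ y² = x³ + k`** (`j = 0`): the displayed binder `h2`
of the Kriz–Li corner files is the tree theorem `JZero.lFunction_two_eq_zero_of_j_eq_zero` (`c₄(y² = x³ + k) = 0`).
[cite: IrelandRosen1990, Ch. 18 §3, Theorem 4] -/
theorem lFunction_two_binder_of_mordell (W : WeierstrassCurve ℚ) [W.IsElliptic] [W.IsGloballyMinimal] {k : ℚ}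
    (hW : ∃ C : VariableChange ℚ, C • W = mordellCurve k) :
    (haveI : Fact (Nat.Prime 2) := ⟨Nat.prime_two⟩; W.HasGoodReductionAtPrime 2) → W.LFunction 2 = 0 := by
  obtain ⟨C, hC⟩ := hW
  exact JZero.lFunction_two_eq_zero_binder_of_smul_c₄_eq_zero W hC (mordellCurve_c₄ k)

/-! ## §1 QT27₊ (`q ≡ 5 (mod 12)`): prime-pair certificates -/

/-- **QT27₊ through the Kriz–Li door for a prime pair `(q, −r)`, binder `h2` discharged**: as
`KrizLiCornerQT27.heegner_and_twist_L_one_ne_zero_of_prime_pair` without the hypothesis `a₂(W) = 0` if good at `2`.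
[cite: KrizLi2019, Thm. 1.20 (pp. 7–8), §1.5 (1), §10.3] [cite: GrossZagier1986, Thm. I.(6.3), V.§1–2] -/
theorem heegner_and_twist_L_one_ne_zero_of_prime_pair' (hKL : thm120_padicLogHeegner_unit_of_bernoulli)
    {q r : ℕ} [hq : Fact q.Prime] [hrp : Fact r.Prime] (hq4 : q % 4 = 1) (hr4 : r % 4 = 3)
    (hr3 : r ≠ 3) (h1 : jacobiSym 3 q = -1)
    (hs3 : jacobiSym (-(r : ℤ)) 3 = 1) (hsq : jacobiSym (-(r : ℤ)) q = 1)
    (hS₁ : ¬ ((3 : ℤ) ∣ ∑ j ∈ Finset.range (q * r),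
      legendreSym q (j : ℤ) * legendreSym r (j : ℤ) * (j : ℤ)))
    (hS₂ : (3 : ℤ) ∣ ∑ j ∈ Finset.range (q * 3),
      legendreSym q (j : ℤ) * legendreSym 3 (j : ℤ) * (j : ℤ) ^ (0 + 1))
    (hS₂' : ¬ ((3 : ℤ) ^ 2 ∣ ∑ j ∈ Finset.range (q * 3),
      legendreSym q (j : ℤ) * legendreSym 3 (j : ℤ) * (j : ℤ) ^ (0 + 1)))
    (W : WeierstrassCurve ℚ) [W.IsElliptic] [W.IsGloballyMinimal] [NeZero (W.conductorNorm ℤ)]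
    {m : ℤ} (hm : m ≠ 0) (hW : ∃ C : VariableChange ℚ, C • W = mordellCurve ((q : ℚ) * (m : ℚ) ^ 2))
    (h6 : ∀ ℓ : ℕ, ℓ.Prime → ¬ ((ℓ : ℤ) ^ 6 ∣ (q : ℤ) * m ^ 2))
    (hS : ∀ ℓ : ℕ, (hℓ : ℓ.Prime) → ¬ (haveI := Fact.mk hℓ; W.HasGoodReductionAtPrime ℓ) →
      ℓ = 3 ∨ ℓ = q ∨ (ℓ % 3 = 1 ∧ jacobiSym (ℓ : ℤ) q = -1 ∧ jacobiSym (-(r : ℤ)) ℓ = 1))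
    (hr1 : W.analyticRank ≠ 0)
    (K : Type) [Field K] [NumberField K] (hK : IsImaginaryQuadratic K) (hdK : NumberField.discr K = -(r : ℤ))
    (hGZ : gross_zagier (W.conductorNorm ℤ) W K) (hHP : exists_isHeegnerPoint W K) :
    SatisfiesHeegnerHypothesis (W.conductorNorm ℤ) K ∧
      (W.quadraticTwist (NumberField.discr K : ℚ)).entireLFunction 1 ≠ 0 ∧
      (W.quadraticTwist (NumberField.discr K : ℚ)).analyticRank = 0 :=
  KrizLiCornerQT27.heegner_and_twist_L_one_ne_zero_of_prime_pair hKL hq4 hr4 hr3 h1 hs3 hsq hS₁ hS₂ hS₂' W hm hW h6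
    (lFunction_two_binder_of_mordell W hW) hS hr1 K hK hdK hGZ hHP

/-- **The crux's `∃ K′` at `(W, q)` (QT27₊) from a prime-pair certificate with `h(−r) < q`, binder `h2` discharged**: as
`KrizLiCornerQT27.exists_cruxConclusion_of_prime_pair` without the hypothesis `a₂(W) = 0` if good at `2`.
[cite: KrizLi2019, Thm. 1.20 (pp. 7–8)] [cite: GrossZagier1986, Thm. I.(6.3), V.§1–2] -/
theorem exists_cruxConclusion_of_prime_pair' (hKL : thm120_padicLogHeegner_unit_of_bernoulli)
    (hGZ : ∀ (N : ℕ) [NeZero N] (W : WeierstrassCurve ℚ) (K : Type) [Field K] [NumberField K], gross_zagier N W K)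
    (hHP : ∀ (W : WeierstrassCurve ℚ) (K : Type) [Field K] [NumberField K], exists_isHeegnerPoint W K)
    {q r : ℕ} [hq : Fact q.Prime] [hrp : Fact r.Prime] (hq4 : q % 4 = 1) (hr4 : r % 4 = 3)
    (hr3 : r ≠ 3) (h1 : jacobiSym 3 q = -1)
    (hs3 : jacobiSym (-(r : ℤ)) 3 = 1) (hsq : jacobiSym (-(r : ℤ)) q = 1)
    (hS₁ : ¬ ((3 : ℤ) ∣ ∑ j ∈ Finset.range (q * r),
      legendreSym q (j : ℤ) * legendreSym r (j : ℤ) * (j : ℤ)))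
    (hS₂ : (3 : ℤ) ∣ ∑ j ∈ Finset.range (q * 3),
      legendreSym q (j : ℤ) * legendreSym 3 (j : ℤ) * (j : ℤ) ^ (0 + 1))
    (hS₂' : ¬ ((3 : ℤ) ^ 2 ∣ ∑ j ∈ Finset.range (q * 3),
      legendreSym q (j : ℤ) * legendreSym 3 (j : ℤ) * (j : ℤ) ^ (0 + 1)))
    {h : ℕ} (hclass : BinQF.classNumber (-(r : ℤ)) = h) (hhq : h < q)
    (W : WeierstrassCurve ℚ) [W.IsElliptic] [W.IsGloballyMinimal] [NeZero (W.conductorNorm ℤ)]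
    {m : ℤ} (hm : m ≠ 0) (hW : ∃ C : VariableChange ℚ, C • W = mordellCurve ((q : ℚ) * (m : ℚ) ^ 2))
    (h6 : ∀ ℓ : ℕ, ℓ.Prime → ¬ ((ℓ : ℤ) ^ 6 ∣ (q : ℤ) * m ^ 2))
    (hS : ∀ ℓ : ℕ, (hℓ : ℓ.Prime) → ¬ (haveI := Fact.mk hℓ; W.HasGoodReductionAtPrime ℓ) →
      ℓ = 3 ∨ ℓ = q ∨ (ℓ % 3 = 1 ∧ jacobiSym (ℓ : ℤ) q = -1 ∧ jacobiSym (-(r : ℤ)) ℓ = 1))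
    (hr1 : W.analyticRank ≠ 0) :
    ∃ (K : Type) (_ : Field K) (_ : NumberField K),
      IsImaginaryQuadratic K ∧ 4 < (NumberField.discr K).natAbs ∧
      SatisfiesHeegnerHypothesis (W.conductorNorm ℤ) K ∧
      (W.quadraticTwist (NumberField.discr K : ℚ)).entireLFunction 1 ≠ 0 ∧ ¬ q ∣ NumberField.classNumber K :=
  KrizLiCornerQT27.exists_cruxConclusion_of_prime_pair hKL hGZ hHP hq4 hr4 hr3 h1 hs3 hsq hS₁ hS₂ hS₂' hclass hhq W hm hW h6
    (lFunction_two_binder_of_mordell W hW) hS hr1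

/-! ## §2 X12₊ ∪ QT27₊ (`q ≡ 11 (mod 12)`): prime-pair certificates -/

/-- **`q ≡ 11 (mod 12)` through the Kriz–Li door for a prime pair `(q, −r)`, binder `h2` discharged**: as
`KrizLiCornerX12.heegner_and_twist_L_one_ne_zero_of_prime_pair_three_mod_four` without the hypothesis `a₂(W) = 0` if good at `2`.
[cite: KrizLi2019, Thm. 1.20 (pp. 7–8), §1.5 (1), §10.3] [cite: GrossZagier1986, Thm. I.(6.3), V.§1–2] -/
theorem heegner_and_twist_L_one_ne_zero_of_prime_pair_three_mod_four' (hKL : thm120_padicLogHeegner_unit_of_bernoulli)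
    {q r : ℕ} [hq : Fact q.Prime] [hrp : Fact r.Prime] (hq4 : q % 4 = 3) (h3q : jacobiSym 3 q = 1)
    (hr8 : r % 8 = 7) (hr3 : r ≠ 3) (hs3 : jacobiSym (-(r : ℤ)) 3 = 1) (hsq : jacobiSym (-(r : ℤ)) q = 1)
    (hS₁ : ¬ ((3 : ℤ) ∣ ∑ j ∈ Finset.range (4 * q * r),
      (ZMod.χ₄ (j : ZMod 4) * J((j : ℤ) | q) : ℤ) * jacobiSym (j : ℤ) r * (j : ℤ)))
    (hS₂ : (3 : ℤ) ∣ ∑ j ∈ Finset.range (4 * q * 3),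
      (ZMod.χ₄ (j : ZMod 4) * J((j : ℤ) | q) : ℤ) * jacobiSym (j : ℤ) 3 * (j : ℤ) ^ (0 + 1))
    (hS₂' : ¬ ((3 : ℤ) ^ 2 ∣ ∑ j ∈ Finset.range (4 * q * 3),
      (ZMod.χ₄ (j : ZMod 4) * J((j : ℤ) | q) : ℤ) * jacobiSym (j : ℤ) 3 * (j : ℤ) ^ (0 + 1)))
    (W : WeierstrassCurve ℚ) [W.IsElliptic] [W.IsGloballyMinimal] [NeZero (W.conductorNorm ℤ)]
    {m : ℤ} (hm : m ≠ 0) (hW : ∃ C : VariableChange ℚ, C • W = mordellCurve ((q : ℚ) * (m : ℚ) ^ 2))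
    (h6 : ∀ ℓ : ℕ, ℓ.Prime → ¬ ((ℓ : ℤ) ^ 6 ∣ (q : ℤ) * m ^ 2))
    (hS : ∀ ℓ : ℕ, (hℓ : ℓ.Prime) → ¬ (haveI := Fact.mk hℓ; W.HasGoodReductionAtPrime ℓ) →
      ℓ = 2 ∨ ℓ = 3 ∨ ℓ = q)
    (hr1 : W.analyticRank ≠ 0)
    (K : Type) [Field K] [NumberField K] (hK : IsImaginaryQuadratic K) (hdK : NumberField.discr K = -(r : ℤ))
    (hGZ : gross_zagier (W.conductorNorm ℤ) W K) (hHP : exists_isHeegnerPoint W K) :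
    SatisfiesHeegnerHypothesis (W.conductorNorm ℤ) K ∧
      (W.quadraticTwist (NumberField.discr K : ℚ)).entireLFunction 1 ≠ 0 ∧
      (W.quadraticTwist (NumberField.discr K : ℚ)).analyticRank = 0 :=
  KrizLiCornerX12.heegner_and_twist_L_one_ne_zero_of_prime_pair_three_mod_four hKL hq4 h3q hr8 hr3 hs3 hsq hS₁ hS₂ hS₂' W hm
    hW h6 (lFunction_two_binder_of_mordell W hW) hS hr1 K hK hdK hGZ hHP

/-- **The crux's `∃ K′` at `(W, q)`, `q ≡ 11 (mod 12)`, from a prime-pair certificate with `h(−r) < q`, binder `h2` discharged**: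
as `KrizLiCornerX12.exists_cruxConclusion_of_prime_pair_three_mod_four` without the hypothesis `a₂(W) = 0` if good at `2`.
[cite: KrizLi2019, Thm. 1.20 (pp. 7–8)] [cite: GrossZagier1986, Thm. I.(6.3), V.§1–2] -/
theorem exists_cruxConclusion_of_prime_pair_three_mod_four' (hKL : thm120_padicLogHeegner_unit_of_bernoulli)
    (hGZ : ∀ (N : ℕ) [NeZero N] (W : WeierstrassCurve ℚ) (K : Type) [Field K] [NumberField K], gross_zagier N W K)
    (hHP : ∀ (W : WeierstrassCurve ℚ) (K : Type) [Field K] [NumberField K], exists_isHeegnerPoint W K)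
    {q r : ℕ} [hq : Fact q.Prime] [hrp : Fact r.Prime] (hq4 : q % 4 = 3) (h3q : jacobiSym 3 q = 1)
    (hr8 : r % 8 = 7) (hr3 : r ≠ 3) (hs3 : jacobiSym (-(r : ℤ)) 3 = 1) (hsq : jacobiSym (-(r : ℤ)) q = 1)
    (hS₁ : ¬ ((3 : ℤ) ∣ ∑ j ∈ Finset.range (4 * q * r),
      (ZMod.χ₄ (j : ZMod 4) * J((j : ℤ) | q) : ℤ) * jacobiSym (j : ℤ) r * (j : ℤ)))
    (hS₂ : (3 : ℤ) ∣ ∑ j ∈ Finset.range (4 * q * 3),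
      (ZMod.χ₄ (j : ZMod 4) * J((j : ℤ) | q) : ℤ) * jacobiSym (j : ℤ) 3 * (j : ℤ) ^ (0 + 1))
    (hS₂' : ¬ ((3 : ℤ) ^ 2 ∣ ∑ j ∈ Finset.range (4 * q * 3),
      (ZMod.χ₄ (j : ZMod 4) * J((j : ℤ) | q) : ℤ) * jacobiSym (j : ℤ) 3 * (j : ℤ) ^ (0 + 1)))
    {h : ℕ} (hclass : BinQF.classNumber (-(r : ℤ)) = h) (hhq : h < q)
    (W : WeierstrassCurve ℚ) [W.IsElliptic] [W.IsGloballyMinimal] [NeZero (W.conductorNorm ℤ)]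
    {m : ℤ} (hm : m ≠ 0) (hW : ∃ C : VariableChange ℚ, C • W = mordellCurve ((q : ℚ) * (m : ℚ) ^ 2))
    (h6 : ∀ ℓ : ℕ, ℓ.Prime → ¬ ((ℓ : ℤ) ^ 6 ∣ (q : ℤ) * m ^ 2))
    (hS : ∀ ℓ : ℕ, (hℓ : ℓ.Prime) → ¬ (haveI := Fact.mk hℓ; W.HasGoodReductionAtPrime ℓ) →
      ℓ = 2 ∨ ℓ = 3 ∨ ℓ = q)
    (hr1 : W.analyticRank ≠ 0) :
    ∃ (K : Type) (_ : Field K) (_ : NumberField K),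
      IsImaginaryQuadratic K ∧ 4 < (NumberField.discr K).natAbs ∧
      SatisfiesHeegnerHypothesis (W.conductorNorm ℤ) K ∧
      (W.quadraticTwist (NumberField.discr K : ℚ)).entireLFunction 1 ≠ 0 ∧ ¬ q ∣ NumberField.classNumber K :=
  KrizLiCornerX12.exists_cruxConclusion_of_prime_pair_three_mod_four hKL hGZ hHP hq4 h3q hr8 hr3 hs3 hsq hS₁ hS₂ hS₂' hclass hhq
    W hm hW h6 (lFunction_two_binder_of_mordell W hW) hS hr1

/-! ## §3 Class-number certificates -/

/-- **QT27₊ with class-number certificates, binder `h2` discharged**: as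
`KrizLiCornerClassNumber.exists_cruxConclusion_of_classNumbers` without the hypothesis `a₂(W) = 0` if good at `2`.
[cite: KrizLi2019, Thm. 1.20 (pp. 7–8)] [cite: Washington1997, Thm. 4.17] [cite: GrossZagier1986, Thm. I.(6.3), V.§1–2] -/
theorem exists_cruxConclusion_of_classNumbers' (hKL : thm120_padicLogHeegner_unit_of_bernoulli)
    (hGZ : ∀ (N : ℕ) [NeZero N] (W : WeierstrassCurve ℚ) (K : Type) [Field K] [NumberField K], gross_zagier N W K)
    (hHP : ∀ (W : WeierstrassCurve ℚ) (K : Type) [Field K] [NumberField K], exists_isHeegnerPoint W K)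
    {q r : ℕ} [hq : Fact q.Prime] [hrp : Fact r.Prime] (hq4 : q % 4 = 1) (hr4 : r % 4 = 3)
    (hr3 : r ≠ 3) (h1 : jacobiSym 3 q = -1)
    (hs3 : jacobiSym (-(r : ℤ)) 3 = 1) (hsq : jacobiSym (-(r : ℤ)) q = 1)
    (h3q : ¬ 3 ∣ BinQF.classNumber (-((q * 3 : ℕ) : ℤ))) (hqr : ¬ 3 ∣ BinQF.classNumber (-((q * r : ℕ) : ℤ)))
    {h : ℕ} (hclass : BinQF.classNumber (-(r : ℤ)) = h) (hhq : h < q)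
    (W : WeierstrassCurve ℚ) [W.IsElliptic] [W.IsGloballyMinimal] [NeZero (W.conductorNorm ℤ)]
    {m : ℤ} (hm : m ≠ 0) (hW : ∃ C : VariableChange ℚ, C • W = mordellCurve ((q : ℚ) * (m : ℚ) ^ 2))
    (h6 : ∀ ℓ : ℕ, ℓ.Prime → ¬ ((ℓ : ℤ) ^ 6 ∣ (q : ℤ) * m ^ 2))
    (hS : ∀ ℓ : ℕ, (hℓ : ℓ.Prime) → ¬ (haveI := Fact.mk hℓ; W.HasGoodReductionAtPrime ℓ) →
      ℓ = 3 ∨ ℓ = q ∨ (ℓ % 3 = 1 ∧ jacobiSym (ℓ : ℤ) q = -1 ∧ jacobiSym (-(r : ℤ)) ℓ = 1))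
    (hr1 : W.analyticRank ≠ 0) :
    ∃ (K : Type) (_ : Field K) (_ : NumberField K),
      IsImaginaryQuadratic K ∧ 4 < (NumberField.discr K).natAbs ∧
      SatisfiesHeegnerHypothesis (W.conductorNorm ℤ) K ∧
      (W.quadraticTwist (NumberField.discr K : ℚ)).entireLFunction 1 ≠ 0 ∧ ¬ q ∣ NumberField.classNumber K :=
  KrizLiCornerClassNumber.exists_cruxConclusion_of_classNumbers hKL hGZ hHP hq4 hr4 hr3 h1 hs3 hsq h3q hqr hclass hhq W hm hW h6
    (lFunction_two_binder_of_mordell W hW) hS hr1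

/-- **`q ≡ 11 (mod 12)` with class-number certificates, binder `h2` discharged**: as
`KrizLiCornerClassNumber.exists_cruxConclusion_three_mod_four_of_classNumbers` without the hypothesis `a₂(W) = 0` if good at `2`.
[cite: KrizLi2019, Thm. 1.20 (pp. 7–8)] [cite: Washington1997, Thm. 4.17] [cite: GrossZagier1986, Thm. I.(6.3), V.§1–2] -/
theorem exists_cruxConclusion_three_mod_four_of_classNumbers' (hKL : thm120_padicLogHeegner_unit_of_bernoulli)
    (hGZ : ∀ (N : ℕ) [NeZero N] (W : WeierstrassCurve ℚ) (K : Type) [Field K] [NumberField K], gross_zagier N W K)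
    (hHP : ∀ (W : WeierstrassCurve ℚ) (K : Type) [Field K] [NumberField K], exists_isHeegnerPoint W K)
    {q r : ℕ} [hq : Fact q.Prime] [hrp : Fact r.Prime] (hq4 : q % 4 = 3) (h3j : jacobiSym 3 q = 1)
    (hr8 : r % 8 = 7) (hr3 : r ≠ 3) (hs3 : jacobiSym (-(r : ℤ)) 3 = 1) (hsq : jacobiSym (-(r : ℤ)) q = 1)
    (h12q : ¬ 3 ∣ BinQF.classNumber (-((4 * q * 3 : ℕ) : ℤ))) (h4qr : ¬ 3 ∣ BinQF.classNumber (-((4 * q * r : ℕ) : ℤ)))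
    {h : ℕ} (hclass : BinQF.classNumber (-(r : ℤ)) = h) (hhq : h < q)
    (W : WeierstrassCurve ℚ) [W.IsElliptic] [W.IsGloballyMinimal] [NeZero (W.conductorNorm ℤ)]
    {m : ℤ} (hm : m ≠ 0) (hW : ∃ C : VariableChange ℚ, C • W = mordellCurve ((q : ℚ) * (m : ℚ) ^ 2))
    (h6 : ∀ ℓ : ℕ, ℓ.Prime → ¬ ((ℓ : ℤ) ^ 6 ∣ (q : ℤ) * m ^ 2))
    (hS : ∀ ℓ : ℕ, (hℓ : ℓ.Prime) → ¬ (haveI := Fact.mk hℓ; W.HasGoodReductionAtPrime ℓ) →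
      ℓ = 2 ∨ ℓ = 3 ∨ ℓ = q)
    (hr1 : W.analyticRank ≠ 0) :
    ∃ (K : Type) (_ : Field K) (_ : NumberField K),
      IsImaginaryQuadratic K ∧ 4 < (NumberField.discr K).natAbs ∧
      SatisfiesHeegnerHypothesis (W.conductorNorm ℤ) K ∧
      (W.quadraticTwist (NumberField.discr K : ℚ)).entireLFunction 1 ≠ 0 ∧ ¬ q ∣ NumberField.classNumber K :=
  KrizLiCornerClassNumber.exists_cruxConclusion_three_mod_four_of_classNumbers hKL hGZ hHP hq4 h3j hr8 hr3 hs3 hsq h12q h4qr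
    hclass hhq W hm hW h6 (lFunction_two_binder_of_mordell W hW) hS hr1

/-! ## §4 ★ The crux's BODY at `(W, q)` — three print facts and the corner data, nothing else -/

/-- ★ **The crux BODY at `(W, q)`, `q ≡ 5 (mod 12)`, binder `h2` discharged** (QT27₊, class-number certificates `3 ∤ h(−3q)`,
`3 ∤ h(−qr)`, `h(−r) < q`): `HasCM → r_an = 1 → 5 ≤ q → CMInert W q → ¬Good W q → supply → ∃ K′` for every globally minimal
`W ≅ y² = x³ + q·m²` with bad primes `⊂ {3, q}` — modulo `hKL`, `hGZ`, `hHP` ONLY. As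
`KrizLiCornerClassNumber.cruxBody_of_classNumbers` without `h2`. [cite: KrizLi2019, Thm. 1.20 (pp. 7–8)]
[cite: GrossZagier1986, Thm. I.(6.3), V.§1–2] -/
theorem cruxBody_of_classNumbers' (hKL : thm120_padicLogHeegner_unit_of_bernoulli)
    (hGZ : ∀ (N : ℕ) [NeZero N] (W : WeierstrassCurve ℚ) (K : Type) [Field K] [NumberField K], gross_zagier N W K)
    (hHP : ∀ (W : WeierstrassCurve ℚ) (K : Type) [Field K] [NumberField K], exists_isHeegnerPoint W K)
    {q r : ℕ} [Fact q.Prime] [Fact r.Prime] (hq4 : q % 4 = 1) (hr4 : r % 4 = 3) (hr3 : r ≠ 3) (h1 : jacobiSym 3 q = -1)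
    (hs3 : jacobiSym (-(r : ℤ)) 3 = 1) (hsq : jacobiSym (-(r : ℤ)) q = 1)
    (h3q : ¬ 3 ∣ BinQF.classNumber (-((q * 3 : ℕ) : ℤ))) (hqr : ¬ 3 ∣ BinQF.classNumber (-((q * r : ℕ) : ℤ)))
    {h : ℕ} (hclass : BinQF.classNumber (-(r : ℤ)) = h) (hhq : h < q)
    (W : WeierstrassCurve ℚ) [W.IsElliptic] [W.IsGloballyMinimal] [NeZero (W.conductorNorm ℤ)]
    {m : ℤ} (hm : m ≠ 0) (hW : ∃ C : VariableChange ℚ, C • W = mordellCurve ((q : ℚ) * (m : ℚ) ^ 2))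
    (h6 : ∀ ℓ : ℕ, ℓ.Prime → ¬ ((ℓ : ℤ) ^ 6 ∣ (q : ℤ) * m ^ 2))
    (hS : ∀ ℓ : ℕ, (hℓ : ℓ.Prime) → ¬ (haveI := Fact.mk hℓ; W.HasGoodReductionAtPrime ℓ) → ℓ = 3 ∨ ℓ = q) :
    W.HasCM → W.analyticRank = 1 → 5 ≤ q → CMInert W q → ¬ Good W q →
      (∀ B : ℕ, ∃ (K : Type) (_ : Field K) (_ : NumberField K), IsImaginaryQuadratic K ∧ B < (NumberField.discr K).natAbs ∧
        4 < (NumberField.discr K).natAbs ∧ SatisfiesHeegnerHypothesis (W.conductorNorm ℤ) K ∧ ¬ q ∣ NumberField.classNumber K) →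
      ∃ (K : Type) (_ : Field K) (_ : NumberField K),
        IsImaginaryQuadratic K ∧ 4 < (NumberField.discr K).natAbs ∧
        SatisfiesHeegnerHypothesis (W.conductorNorm ℤ) K ∧
        (W.quadraticTwist (NumberField.discr K : ℚ)).entireLFunction 1 ≠ 0 ∧ ¬ q ∣ NumberField.classNumber K :=
  KrizLiCornerClassNumber.cruxBody_of_classNumbers hKL hGZ hHP hq4 hr4 hr3 h1 hs3 hsq h3q hqr hclass hhq W hm hW h6
    (lFunction_two_binder_of_mordell W hW) hS

/-- ★ **The crux BODY at `(W, q)`, `q ≡ 11 (mod 12)`, binder `h2` discharged** (X12₊ ∪ QT27₊, class-number certificates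
`3 ∤ h(−12q)`, `3 ∤ h(−4qr)`, `h(−r) < q`; `r ≡ 7 (mod 8)`): as `KrizLiCornerClassNumber.cruxBody_three_mod_four_of_classNumbers`
without `h2`, for every globally minimal `W ≅ y² = x³ + q·m²` with bad primes `⊂ {2, 3, q}` — modulo `hKL`, `hGZ`, `hHP` ONLY.
[cite: KrizLi2019, Thm. 1.20 (pp. 7–8)] [cite: GrossZagier1986, Thm. I.(6.3), V.§1–2] -/
theorem cruxBody_three_mod_four_of_classNumbers' (hKL : thm120_padicLogHeegner_unit_of_bernoulli)
    (hGZ : ∀ (N : ℕ) [NeZero N] (W : WeierstrassCurve ℚ) (K : Type) [Field K] [NumberField K], gross_zagier N W K)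
    (hHP : ∀ (W : WeierstrassCurve ℚ) (K : Type) [Field K] [NumberField K], exists_isHeegnerPoint W K)
    {q r : ℕ} [Fact q.Prime] [Fact r.Prime] (hq4 : q % 4 = 3) (h3j : jacobiSym 3 q = 1) (hr8 : r % 8 = 7) (hr3 : r ≠ 3)
    (hs3 : jacobiSym (-(r : ℤ)) 3 = 1) (hsq : jacobiSym (-(r : ℤ)) q = 1)
    (h12q : ¬ 3 ∣ BinQF.classNumber (-((4 * q * 3 : ℕ) : ℤ))) (h4qr : ¬ 3 ∣ BinQF.classNumber (-((4 * q * r : ℕ) : ℤ)))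
    {h : ℕ} (hclass : BinQF.classNumber (-(r : ℤ)) = h) (hhq : h < q)
    (W : WeierstrassCurve ℚ) [W.IsElliptic] [W.IsGloballyMinimal] [NeZero (W.conductorNorm ℤ)]
    {m : ℤ} (hm : m ≠ 0) (hW : ∃ C : VariableChange ℚ, C • W = mordellCurve ((q : ℚ) * (m : ℚ) ^ 2))
    (h6 : ∀ ℓ : ℕ, ℓ.Prime → ¬ ((ℓ : ℤ) ^ 6 ∣ (q : ℤ) * m ^ 2))
    (hS : ∀ ℓ : ℕ, (hℓ : ℓ.Prime) → ¬ (haveI := Fact.mk hℓ; W.HasGoodReductionAtPrime ℓ) → ℓ = 2 ∨ ℓ = 3 ∨ ℓ = q) :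
    W.HasCM → W.analyticRank = 1 → 5 ≤ q → CMInert W q → ¬ Good W q →
      (∀ B : ℕ, ∃ (K : Type) (_ : Field K) (_ : NumberField K), IsImaginaryQuadratic K ∧ B < (NumberField.discr K).natAbs ∧
        4 < (NumberField.discr K).natAbs ∧ SatisfiesHeegnerHypothesis (W.conductorNorm ℤ) K ∧ ¬ q ∣ NumberField.classNumber K) →
      ∃ (K : Type) (_ : Field K) (_ : NumberField K),
        IsImaginaryQuadratic K ∧ 4 < (NumberField.discr K).natAbs ∧
        SatisfiesHeegnerHypothesis (W.conductorNorm ℤ) K ∧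
        (W.quadraticTwist (NumberField.discr K : ℚ)).entireLFunction 1 ≠ 0 ∧ ¬ q ∣ NumberField.classNumber K :=
  KrizLiCornerClassNumber.cruxBody_three_mod_four_of_classNumbers hKL hGZ hHP hq4 h3j hr8 hr3 hs3 hsq h12q h4qr hclass hhq W hm
    hW h6 (lFunction_two_binder_of_mordell W hW) hS

end Summit.BirchSwinnertonDyer.BirchSwinnertonDyer.Theorems.KrizLiCornerGoodAtTwo

end
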